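import Summits.BirchSwinnertonDyer.BirchSwinnertonDyer.Theorems.CyclotomicUntwistPSKodairaDictionary
import Summits.BirchSwinnertonDyer.BirchSwinnertonDyer.Theorems.CyclotomicUntwistGNineRamification
import Literature.NumberTheory.EllipticCurves.TamagawaSubgroupProofs
import HarnessLib

/-!
# The PS / cyclic-wild dictionary at `3`, part 2: the facts from the K1-stub binders (`ClassO6 ∧ TypeGNine`)
# and the stub predicate `3 ∣ W.tamagawaProduct` localised away from `3`

Cell `pub/bsd-wall` (D-0145 line `route-BirchSwinnertonDyer-CyclotomicUntwist`), seat `bsd-line-cycu-p4`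
(width seat 4, gen 2); sequel of `Theorems/CyclotomicUntwistPSKodairaDictionary.lean` (p597133), helper toward
K1 `PSRankOneLowerHalfAtThree` (stmt-BirchSwinnertonDyer-21580) / K2 `PSRankOneUpperHalfAtThree`
(stmt-BirchSwinnertonDyer-21581). THEOREMS ONLY (no definition, no named fact, no `sorry`, no instance); BSD is
not proved by this file and no crux is.

* §6 `typeGNine_row_facts`: from the binders `ClassO6 W 3 ∧ TypeGNine W` of the registered K1 stubs
  (`Cruxes/PSRankOneLowerHalfAtThree/Lines/birth.lean`): `f₃ = 4`, `E[3]|G_{ℚ₃}` reducible, `c₃ ∈ {1, 3}`,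
  `ord₃ c₃ ≤ 1`, and `4 ∣ v₃(Δ_min) → c₃ = 1` — via cycu-p2's `GNineCriterion.subWCyclic_of_subW_of_typeGNine`
  ((G₉) rows have `v₃(Δ_min)` even) and part 1.
* §7 `three_dvd_tamagawaProduct_iff` (`3 ∣ ∏ᶠ_v c_v ↔ ∃ v, 3 ∣ c_v`, finite support),
  `three_dvd_tamagawaProduct_iff_of_four_dvd` (on the `η`-order-`3` rows the K1-stub-2 predicate
  `3 ∣ W.tamagawaProduct` is a condition at the places NOT above `3`), `three_dvd_tamagawaProduct_iff_of_even`
  (on every cyclic row: `3 ∣ ∏ c_v` iff `c₃ = 3` — then Kodaira IV/IV* — or `3 ∣ c_v` at some `v ∤ 3`).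

References: J. H. Silverman, *Advanced Topics in the Arithmetic of Elliptic Curves*, GTM 151 (1994), IV.9.4,
IV.10.4 [SilvermanATAEC1994]; J. H. Silverman, *The Arithmetic of Elliptic Curves*, GTM 106 (2009), VII.6
[SilvermanAEC2009]; A. Kraus, Manuscripta Math. 69 (1990) [Kraus1990].
-/

noncomputable section

open scoped Classical NumberField

open WeierstrassCurve IsDedekindDomain Rat.HeightOneSpectrum Literature.NumberTheory.EllipticCurves
  Literature.NumberTheory.EllipticCurves.Rank1Residual Literature.NumberTheory.DiophantineGeometry
  Summit.BirchSwinnertonDyer.Rank1Residual.Additive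

-- single-conjunct summit: `Summit.BirchSwinnertonDyer.BirchSwinnertonDyer.…` repeats the name by design
set_option linter.dupNamespace false
set_option autoImplicit false

namespace Summit.BirchSwinnertonDyer.BirchSwinnertonDyer.Theorems.PSTamagawaProduct

open Summit.BirchSwinnertonDyer.BirchSwinnertonDyer.Theorems.PSKodairaDictionary

variable (W : WeierstrassCurve ℚ) [W.IsElliptic] [W.IsGloballyMinimal]

/-! ### §6 The same facts from the binders of the K1 stubs (`ClassO6 W 3 ∧ TypeGNine W`)

The registered stubs `stub_rung_lowerHalfOnGNine_towerUnit` / `stub_lowerHalfOnGNine_rest` of the line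
`Cruxes/PSRankOneLowerHalfAtThree/Lines/birth.lean` carry `TypeGNine W` (not the parity of `v₃(Δ_min)`); the
cheap half of the converse of `GNineCriterion` (`GNineCriterion.subWCyclic_of_subW_of_typeGNine`, cycu-p2) puts
these rows in the cyclic cell, so every theorem above is available to a stub worker from its own binders. -/

/-- **Local facts at `3` from the K1-stub binders**: `ClassO6 W 3 → TypeGNine W →` (`f₃ = 4`, `E[3]|G_{ℚ₃}`
reducible, `c₃ ∈ {1, 3}`, `ord₃ c₃ ≤ 1`, and `4 ∣ v₃(Δ_min) → c₃ = 1`).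
[cite: Kraus1990, Théorème (p = 3)] [cite: SilvermanATAEC1994, IV.9.4 and IV.10.4] -/
theorem typeGNine_row_facts (hO6 : ClassO6 W 3) (hG : TypeGNine W) :
    condExp W 3 = 4 ∧ ¬ LocIrr W 3 ∧
      ((W.baseChange ℚ_[3]).localTamagawaNumber ℤ_[3] = 1 ∨ (W.baseChange ℚ_[3]).localTamagawaNumber ℤ_[3] = 3) ∧
      padicValNat 3 ((W.baseChange ℚ_[3]).localTamagawaNumber ℤ_[3]) ≤ 1 ∧
      (4 ∣ padicValInt 3 W.minimalDiscriminantInt → (W.baseChange ℚ_[3]).localTamagawaNumber ℤ_[3] = 1) := by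
  obtain ⟨-, hadd, hW⟩ := hO6
  have hev : Even (padicValInt 3 W.minimalDiscriminantInt) :=
    (GNineCriterion.subWCyclic_of_subW_of_typeGNine W hW hG).2
  exact ⟨(condExp_eq_four_iff_even W hadd hW).mpr hev, not_locIrr_three_of_even W hadd hW hev,
    localTamagawaNumber_three_of_even W hadd hW hev,
    padicValNat_localTamagawaNumber_three_le_one_of_even W hadd hW hev,
    fun h4 ↦ localTamagawaNumber_three_eq_one_of_four_dvd W hadd hW h4⟩

/-! ### §7 The stub predicate `3 ∣ W.tamagawaProduct`, localised

`W.tamagawaProduct = ∏ᶠ_v c_v` over the finite places of `𝓞 ℚ` (tree `Tamagawa.lean`); a prime divides it iff it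
divides some local factor, and on the `η`-order-`3` rows the factor at `3` is `1`, so the K1-stub-2 predicate
`¬ 3 ∣ W.tamagawaProduct` is a condition on the primes `ℓ ≠ 3` of bad reduction only. -/

omit [W.IsGloballyMinimal] in
/-- **`3 ∣ ∏_v c_v` iff `3 ∣ c_v` for some finite place `v`** (finite multiplicative support,
`mulSupport_localTamagawaNumber_finite_holds`; `3` is prime). [cite: SilvermanAEC2009, Cor. VII.6.2] -/
theorem three_dvd_tamagawaProduct_iff :
    3 ∣ W.tamagawaProduct ↔ ∃ v : HeightOneSpectrum (𝓞 ℚ),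
      3 ∣ (W.baseChange (v.adicCompletion ℚ)).localTamagawaNumber (v.adicCompletionIntegers ℚ) := by
  have hfin := W.mulSupport_localTamagawaNumber_finite_holds
  have h3 : Prime 3 := Nat.prime_iff.mp Nat.prime_three
  unfold WeierstrassCurve.tamagawaProduct
  rw [finprod_eq_prod _ hfin, h3.dvd_finsetProd_iff]
  constructor
  · rintro ⟨v, -, hv⟩
    exact ⟨v, hv⟩
  · rintro ⟨v, hv⟩
    refine ⟨v, ?_, hv⟩
    rw [Set.Finite.mem_toFinset, Function.mem_mulSupport]
    intro h1
    rw [h1] at hv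
    exact absurd hv (by decide)

omit [W.IsGloballyMinimal] in
/-- **The place-indexed factor above `ℓ` is `c_ℓ`** (the tree bridge `localTamagawaNumber_padic_eq_holds` at the
place of `𝓞 ℚ` over `ℓ`). [cite: SilvermanAEC2009, VII.6 Ex. 7.6] -/
theorem localTamagawaNumber_eq_padic_of_primesEquiv_eq (v : HeightOneSpectrum (𝓞 ℚ)) (ℓ : ℕ) [Fact ℓ.Prime]
    (hv : (primesEquiv v : ℕ) = ℓ) :
    (W.baseChange (v.adicCompletion ℚ)).localTamagawaNumber (v.adicCompletionIntegers ℚ) =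
      (W.baseChange ℚ_[ℓ]).localTamagawaNumber ℤ_[ℓ] :=
  (WeierstrassCurve.localTamagawaNumber_padic_eq_holds W v ℓ hv).symm

/-- **On the `η`-order-`3` rows the stub predicate lives away from `3`**: for `W` on the wild cell with
`4 ∣ v₃(Δ_min)` (Kodaira II/II*, `c₃ = 1`), `3 ∣ W.tamagawaProduct` iff `3 ∣ c_v` at some finite place `v` NOT
above `3`. [cite: SilvermanATAEC1994, IV.9.4 Steps 3 and 10] [cite: SilvermanAEC2009, Cor. VII.6.2] -/
theorem three_dvd_tamagawaProduct_iff_of_four_dvd (hadd : Addv W 3) (hW : SubW W 3)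
    (h4 : 4 ∣ padicValInt 3 W.minimalDiscriminantInt) :
    3 ∣ W.tamagawaProduct ↔ ∃ v : HeightOneSpectrum (𝓞 ℚ), (primesEquiv v : ℕ) ≠ 3 ∧
      3 ∣ (W.baseChange (v.adicCompletion ℚ)).localTamagawaNumber (v.adicCompletionIntegers ℚ) := by
  rw [three_dvd_tamagawaProduct_iff W]
  constructor
  · rintro ⟨v, hv⟩
    refine ⟨v, fun h3 ↦ ?_, hv⟩
    rw [localTamagawaNumber_eq_padic_of_primesEquiv_eq W v 3 h3,
      localTamagawaNumber_three_eq_one_of_four_dvd W hadd hW h4] at hv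
    exact absurd hv (by decide)
  · rintro ⟨v, -, hv⟩
    exact ⟨v, hv⟩

/-- **On every cyclic row the factor at `3` contributes at most one `3`**: `3 ∣ W.tamagawaProduct` iff
`c₃ = 3` (then Kodaira IV/IV*, `v₃(Δ_min) ∈ {6, 10}`) or `3 ∣ c_v` at some place `v` not above `3`.
[cite: SilvermanATAEC1994, IV.9.4 and Table 4.1] [cite: SilvermanAEC2009, Cor. VII.6.2] -/
theorem three_dvd_tamagawaProduct_iff_of_even (hadd : Addv W 3) (hW : SubW W 3)
    (hev : Even (padicValInt 3 W.minimalDiscriminantInt)) :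
    3 ∣ W.tamagawaProduct ↔
      ((W.baseChange ℚ_[3]).localTamagawaNumber ℤ_[3] = 3 ∧ HasKodairaIVOrIVstarAt W 3) ∨
      ∃ v : HeightOneSpectrum (𝓞 ℚ), (primesEquiv v : ℕ) ≠ 3 ∧
        3 ∣ (W.baseChange (v.adicCompletion ℚ)).localTamagawaNumber (v.adicCompletionIntegers ℚ) := by
  rw [three_dvd_tamagawaProduct_iff W]
  constructor
  · rintro ⟨v, hv⟩
    by_cases h3 : (primesEquiv v : ℕ) = 3
    · rw [localTamagawaNumber_eq_padic_of_primesEquiv_eq W v 3 h3] at hv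
      refine Or.inl ⟨?_, (mod_four_eq_two_of_three_dvd_localTamagawaNumber W hadd hW hev hv).2⟩
      rcases localTamagawaNumber_three_of_even W hadd hW hev with h | h
      · rw [h] at hv; exact absurd hv (by decide)
      · exact h
    · exact Or.inr ⟨v, h3, hv⟩
  · rintro (⟨hc, -⟩ | ⟨v, -, hv⟩)
    · refine ⟨primesEquiv.symm ⟨3, Nat.prime_three⟩, ?_⟩
      rw [localTamagawaNumber_eq_padic_of_primesEquiv_eq W _ 3 (by simp), hc]
    · exact ⟨v, hv⟩

end Summit.BirchSwinnertonDyer.BirchSwinnertonDyer.Theorems.PSTamagawaProduct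

end
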